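import Summits.CriticalPhenomena.PercolationContinuityZ3.Theorems.PercNearOneGluingNoHeavyQuantFarRelayRow
import HarnessLib

/-!
# QUANT lane R8: the PROFILE rows of the far-relay family — a two-event exchange lemma and the rows `(j, 0)`

builds on p205010 (kernel theorem, internal audit signed; external expert review pending)

Support file (`--supports stmt-CriticalPhenomena-4575`), seat `prim-quant-p1` (gen 3); memo
`run/shared/lean/prim/quant/P1-SURPLUS.md` §13.  No definitions, no named facts, no sorries; standard axioms.

Vocabulary of `Quant.FarRelayRow` (`…QuantFarRelayRow.lean`): finite weighted graph on `Fin n`, `μ = prodBernoulli w`, observer `o`,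
relay set `A`, `q_a = μ(o ↔ a)`, relay count `N = #{a ∈ A | o ↔ a}`.  FAR at layer `j` reads `EN > 2j ⟹ (1 − q_min)·μ(N ≥ j+1) ≥ q_min·μ(N ≤ j)`.
The PROFILE family of the memo (§13) is the two-parameter set of rows, `0 ≤ ℓ ≤ j`,

  `(j, ℓ)`:  `EN > 2j − (j − ℓ)·q_min ⟹ (1 − q_min)·μ(N ≥ j+1) ≥ q_min·μ(N ≤ ℓ)`,

whose diagonal `ℓ = j` is FAR; it is the shape in which FAR's exchange form fibres over the cluster of the least likely relay, and the
shape needed by an induction over trees (memo §13.2–13.4; census: 0 violations on all graphs `n ≤ 5` × palettes, all rows, and on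
2·10⁴ random weighted trees with integer masses).  This file proves, unconditionally:

* `Quant.twoEvent_exchange` — for increasing events `X, Y` of `prodBernoulli w` with `max(½, μ Y) ≤ μ X`:
  `(1 − μ Y)·μ(X ∩ Y) ≥ μ Y·μ(Xᶜ ∩ Yᶜ)`, i.e. `μ(X | Y) + μ(X | Yᶜ) ≥ 1`.  (Case `μ Y ≥ ½`: only `μ(X ∩ Y) ≤ μ Y`; case `μ Y < ½`: Harris.)
* `Quant.profileRow_zero_of_half_le` — row `(j, 0)` WITHOUT mean hypothesis whenever `max(½, q_y) ≤ μ(N_{A∖y} ≥ j)`: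
  `(1 − q_y)·μ(N ≥ j+1) ≥ q_y·μ(N = 0)` (`X = {N_{A∖y} ≥ j}`, `Y = {o ↔ y}`).
* `Quant.profileRow_one_zero_of_half_le` — row `(1, 0)` for every `A` with two relays `a ≠ b`, `q_b ≤ q_a`, `½ ≤ q_a`, and every
  `s ≤ q_b`: `(1 − s)·μ(N ≥ 2) ≥ s·μ(N = 0)`.
* `Quant.profileRow_one_zero_card_le_three` — row `(1, 0)` of the profile family UNCONDITIONALLY for `2 ≤ |A| ≤ 3`, in FAR's
  vocabulary: `2 − (1 − t) < Σ_a q_a` and `μ(o ↮ a) ≤ t` on `A` imply `(1 − t)·μ(N = 0) ≤ t·μ(N ≥ 2)` (the largest `q` is then `≥ ½`).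
  Equality on the glued pair / glued triple behind one gate (the FAR equality family); for `|A| = 3` this is the `ℓ = 0` companion of
  `OneCutFive.ZeroOneThree` (= row `(1, 1)`), with the weaker hypothesis `Σ q > 2 − q_min`.
* (appended) `Quant.profileRow_zero` — ALL rows `(j, 0)` for EVERY relay set by first-moment counting (`j ≤ Σ_a q_a` and `μ(o ↮ a) ≤ t`
  on `A` imply `(1 − t)·μ(N = 0) ≤ t·μ(N ≥ j+1)`); supersedes the `½`-conditions above for `ℓ = 0`; rows with `ℓ ≥ 1` are NOT first-moment rows.
[cite: KozmaNitzan2024, Lemma 2 (p. 6), Conjecture 3 (p. 15)] (context: the far-relay family refines the lonely-relay level of KN)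
-/

noncomputable section

namespace Summit.CriticalPhenomena.PercolationContinuityZ3.Theorems

open MeasureTheory Set
open Literature.Probability.LatticeModels (prodBernoulli prodBernoulli_harris)
open Literature.Probability.Percolation
open scoped Classical

namespace Quant

variable {n : ℕ}

/-- **Two-event exchange lemma.**  For increasing events `X, Y` of `prodBernoulli w` on a finite edge set with `μ Y ≤ μ X` and
`½ ≤ μ X`: `(1 − μ Y)·μ(X ∩ Y) ≥ μ Y·μ(Xᶜ ∩ Yᶜ)` — equivalently `μ(X | Y) + μ(X | Yᶜ) ≥ 1`.  If `μ Y ≥ ½` only `μ(X ∩ Y) ≤ μ Y` is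
used; if `μ Y < ½`, Harris' inequality `μ(X ∩ Y) ≥ μ X·μ Y`. [this work; cite: Grimmett1999, Thm. (2.4) p. 34 (Harris)] -/
theorem twoEvent_exchange (w : Sym2 (Fin n) → unitInterval) (X Y : Set (BondConfig (Fin n)))
    (hX : IsUpperSet X) (hY : IsUpperSet Y)
    (hYX : (prodBernoulli w).real Y ≤ (prodBernoulli w).real X) (hhalf : (1 : ℝ) / 2 ≤ (prodBernoulli w).real X) :
    (prodBernoulli w).real Y * (prodBernoulli w).real (Xᶜ ∩ Yᶜ) ≤
      (1 - (prodBernoulli w).real Y) * (prodBernoulli w).real (X ∩ Y) := by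
  set μ := prodBernoulli w with hμ
  have hmeas : ∀ S : Set (BondConfig (Fin n)), MeasurableSet S := fun S => (Set.toFinite S).measurableSet
  set x := μ.real X with hx
  set y := μ.real Y with hy
  set D := μ.real (X ∩ Y) with hD
  -- inclusion–exclusion: `μ(Xᶜ ∩ Yᶜ) = 1 − x − y + D`
  have hIE : μ.real (Xᶜ ∩ Yᶜ) = 1 - x - y + D := by
    have h1 : μ.real (X ∪ Y) + μ.real (X ∩ Y) = μ.real X + μ.real Y := measureReal_union_add_inter (hmeas Y)
    have h2 : μ.real (X ∪ Y)ᶜ = 1 - μ.real (X ∪ Y) := probReal_compl_eq_one_sub (hmeas _)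
    rw [← Set.compl_union, h2]
    linarith
  have hDy : D ≤ y := measureReal_mono Set.inter_subset_right (measure_ne_top _ _)
  have hy0 : 0 ≤ y := measureReal_nonneg
  have hy1 : y ≤ 1 := measureReal_le_one
  have hHarris : x * y ≤ D := by
    rw [hx, hy, hD, hμ]
    exact prodBernoulli_harris w hX hY (hmeas X) (hmeas Y)
  rw [hIE]
  by_cases hyh : (1 : ℝ) / 2 ≤ y
  · -- `(1 − 2y)(D − y) ≥ 0` and `y (x − y) ≥ 0`
    nlinarith [mul_nonneg (by linarith : (0 : ℝ) ≤ 2 * y - 1) (sub_nonneg.2 hDy), mul_nonneg hy0 (sub_nonneg.2 hYX)]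
  · have hyh : y < 1 / 2 := lt_of_not_ge hyh
    -- `(1 − 2y)(D − x y) ≥ 0` and `y (2x − 1)(1 − y) ≥ 0`
    nlinarith [mul_nonneg (by linarith : (0 : ℝ) ≤ 1 - 2 * y) (sub_nonneg.2 hHarris),
      mul_nonneg (mul_nonneg hy0 (by linarith : (0 : ℝ) ≤ 2 * x - 1)) (sub_nonneg.2 hy1)]

/-- The event "at least `k` relays of `B` are joined to `o`" is increasing. [folklore] -/
theorem isUpperSet_le_card_filter_conn (B : Finset (Fin n)) (o : Fin n) (k : ℕ) :
    IsUpperSet {ω : BondConfig (Fin n) | k ≤ (B.filter fun a => ω ∈ openConn o a).card} := by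
  intro ω ω' hle hω
  refine le_trans hω (Finset.card_le_card ?_)
  intro a ha
  rw [Finset.mem_filter] at ha ⊢
  exact ⟨ha.1, isUpperSet_openConn o a hle ha.2⟩

/-- **Profile row `(j, 0)` under a one-half condition, no mean hypothesis.**  For `y ∈ A` and `j ≥ 1`: if
`max(½, q_y) ≤ μ(N_{A∖y} ≥ j)` then `(1 − q_y)·μ(N ≥ j+1) ≥ q_y·μ(N = 0)`.  (Apply `twoEvent_exchange` to `X = {N_{A∖y} ≥ j}`,
`Y = {o ↔ y}`; `X ∩ Y ⊆ {N ≥ j+1}` and `{N = 0} ⊆ Xᶜ ∩ Yᶜ`.) [this work] -/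
theorem profileRow_zero_of_half_le (w : Sym2 (Fin n) → unitInterval) (A : Finset (Fin n)) (o y : Fin n)
    (hy : y ∈ A) (j : ℕ) (hj : 1 ≤ j)
    (hhalf : (1 : ℝ) / 2 ≤ (prodBernoulli w).real
      {ω : BondConfig (Fin n) | j ≤ ((A.erase y).filter fun a => ω ∈ openConn o a).card})
    (hyX : (prodBernoulli w).real (openConn o y) ≤ (prodBernoulli w).real
      {ω : BondConfig (Fin n) | j ≤ ((A.erase y).filter fun a => ω ∈ openConn o a).card}) :
    (prodBernoulli w).real (openConn o y) *
        (prodBernoulli w).real {ω : BondConfig (Fin n) | (A.filter fun a => ω ∈ openConn o a).card = 0} ≤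
      (1 - (prodBernoulli w).real (openConn o y)) *
        (prodBernoulli w).real {ω : BondConfig (Fin n) | j + 1 ≤ (A.filter fun a => ω ∈ openConn o a).card} := by
  set μ := prodBernoulli w with hμ
  set X : Set (BondConfig (Fin n)) := {ω | j ≤ ((A.erase y).filter fun a => ω ∈ openConn o a).card} with hXdef
  set Y : Set (BondConfig (Fin n)) := openConn o y with hYdef
  have hkey := twoEvent_exchange w X Y (isUpperSet_le_card_filter_conn (A.erase y) o j) (isUpperSet_openConn o y) hyX hhalf
  rw [← hμ] at hkey
  -- on `Y`, `N_A = N_{A∖y} + 1`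
  have hsplit : ∀ ω : BondConfig (Fin n), ω ∈ Y →
      (A.filter fun a => ω ∈ openConn o a).card = ((A.erase y).filter fun a => ω ∈ openConn o a).card + 1 := by
    intro ω hω
    have hins : A = insert y (A.erase y) := (Finset.insert_erase hy).symm
    conv_lhs => rw [hins]
    rw [Finset.filter_insert, if_pos hω, Finset.card_insert_of_notMem]
    intro hmem
    exact (Finset.notMem_erase y A) (Finset.mem_filter.1 hmem).1
  have hsub1 : X ∩ Y ⊆ {ω : BondConfig (Fin n) | j + 1 ≤ (A.filter fun a => ω ∈ openConn o a).card} := by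
    rintro ω ⟨hωX, hωY⟩
    show j + 1 ≤ (A.filter fun a => ω ∈ openConn o a).card
    rw [hsplit ω hωY]
    exact Nat.add_le_add_right hωX 1
  have hsub2 : {ω : BondConfig (Fin n) | (A.filter fun a => ω ∈ openConn o a).card = 0} ⊆ Xᶜ ∩ Yᶜ := by
    intro ω hω
    have h0 : (A.filter fun a => ω ∈ openConn o a).card = 0 := hω
    refine ⟨fun hωX => ?_, fun hωY => ?_⟩
    · have hle : ((A.erase y).filter fun a => ω ∈ openConn o a).card ≤ (A.filter fun a => ω ∈ openConn o a).card :=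
        Finset.card_le_card (Finset.filter_subset_filter _ (Finset.erase_subset y A))
      have : j ≤ (A.filter fun a => ω ∈ openConn o a).card := le_trans hωX hle
      omega
    · have : y ∈ A.filter fun a => ω ∈ openConn o a := Finset.mem_filter.2 ⟨hy, hωY⟩
      rw [Finset.card_eq_zero] at h0
      rw [h0] at this
      exact absurd this (Finset.notMem_empty y)
  have hm1 : μ.real (X ∩ Y) ≤ μ.real {ω : BondConfig (Fin n) | j + 1 ≤ (A.filter fun a => ω ∈ openConn o a).card} :=
    measureReal_mono hsub1 (measure_ne_top _ _)
  have hm2 : μ.real {ω : BondConfig (Fin n) | (A.filter fun a => ω ∈ openConn o a).card = 0} ≤ μ.real (Xᶜ ∩ Yᶜ) :=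
    measureReal_mono hsub2 (measure_ne_top _ _)
  have hq0 : 0 ≤ μ.real Y := measureReal_nonneg
  have hq1 : μ.real Y ≤ 1 := measureReal_le_one
  calc μ.real Y * μ.real {ω : BondConfig (Fin n) | (A.filter fun a => ω ∈ openConn o a).card = 0}
      ≤ μ.real Y * μ.real (Xᶜ ∩ Yᶜ) := mul_le_mul_of_nonneg_left hm2 hq0
    _ ≤ (1 - μ.real Y) * μ.real (X ∩ Y) := hkey
    _ ≤ (1 - μ.real Y) * μ.real {ω : BondConfig (Fin n) | j + 1 ≤ (A.filter fun a => ω ∈ openConn o a).card} :=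
        mul_le_mul_of_nonneg_left hm1 (by linarith)

/-- **Profile row `(1, 0)` under a one-half condition, no mean hypothesis.**  If `a ≠ b` are relays of `A` with `q_b ≤ q_a` and
`½ ≤ q_a`, then for every `s ≤ q_b`: `s·μ(N = 0) ≤ (1 − s)·μ(N ≥ 2)`.  (`twoEvent_exchange` with `X = {o ↔ a}`, `Y = {o ↔ b}`;
`{N ≥ 2} ⊇ X ∩ Y`, `{N = 0} ⊆ Xᶜ ∩ Yᶜ`.)  Equality for `s = q_b` on the glued pair `a ≡ b` behind one gate. [this work] -/
theorem profileRow_one_zero_of_half_le (w : Sym2 (Fin n) → unitInterval) (A : Finset (Fin n)) (o a b : Fin n)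
    (ha : a ∈ A) (hb : b ∈ A) (hab : a ≠ b)
    (hba : (prodBernoulli w).real (openConn o b) ≤ (prodBernoulli w).real (openConn o a))
    (hhalf : (1 : ℝ) / 2 ≤ (prodBernoulli w).real (openConn o a))
    (s : ℝ) (hs : s ≤ (prodBernoulli w).real (openConn o b)) :
    s * (prodBernoulli w).real {ω : BondConfig (Fin n) | (A.filter fun x => ω ∈ openConn o x).card = 0} ≤
      (1 - s) * (prodBernoulli w).real {ω : BondConfig (Fin n) | 2 ≤ (A.filter fun x => ω ∈ openConn o x).card} := by
  set μ := prodBernoulli w with hμ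
  set X : Set (BondConfig (Fin n)) := openConn o a with hXdef
  set Y : Set (BondConfig (Fin n)) := openConn o b with hYdef
  have hkey := twoEvent_exchange w X Y (isUpperSet_openConn o a) (isUpperSet_openConn o b) hba hhalf
  rw [← hμ] at hkey
  have hsub1 : X ∩ Y ⊆ {ω : BondConfig (Fin n) | 2 ≤ (A.filter fun x => ω ∈ openConn o x).card} := by
    rintro ω ⟨hωX, hωY⟩
    show 2 ≤ (A.filter fun x => ω ∈ openConn o x).card
    have hsub : ({a, b} : Finset (Fin n)) ⊆ A.filter fun x => ω ∈ openConn o x := by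
      intro x hx
      rw [Finset.mem_insert, Finset.mem_singleton] at hx
      rw [Finset.mem_filter]
      rcases hx with rfl | rfl
      · exact ⟨ha, hωX⟩
      · exact ⟨hb, hωY⟩
    have hcard : ({a, b} : Finset (Fin n)).card = 2 := Finset.card_pair hab
    exact hcard ▸ Finset.card_le_card hsub
  have hsub2 : {ω : BondConfig (Fin n) | (A.filter fun x => ω ∈ openConn o x).card = 0} ⊆ Xᶜ ∩ Yᶜ := by
    intro ω hω
    have h0 : (A.filter fun x => ω ∈ openConn o x).card = 0 := hω
    rw [Finset.card_eq_zero, Finset.filter_eq_empty_iff] at h0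
    exact ⟨fun hωX => h0 ha hωX, fun hωY => h0 hb hωY⟩
  have hm1 : μ.real (X ∩ Y) ≤ μ.real {ω : BondConfig (Fin n) | 2 ≤ (A.filter fun x => ω ∈ openConn o x).card} :=
    measureReal_mono hsub1 (measure_ne_top _ _)
  have hm2 : μ.real {ω : BondConfig (Fin n) | (A.filter fun x => ω ∈ openConn o x).card = 0} ≤ μ.real (Xᶜ ∩ Yᶜ) :=
    measureReal_mono hsub2 (measure_ne_top _ _)
  have hq0 : 0 ≤ μ.real Y := measureReal_nonneg
  have hE0 : 0 ≤ μ.real {ω : BondConfig (Fin n) | (A.filter fun x => ω ∈ openConn o x).card = 0} := measureReal_nonneg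
  have hP0 : 0 ≤ μ.real (X ∩ Y) := measureReal_nonneg
  have hP2 : 0 ≤ μ.real {ω : BondConfig (Fin n) | 2 ≤ (A.filter fun x => ω ∈ openConn o x).card} := measureReal_nonneg
  -- at `s = q_b` from the two-event lemma, then monotone in `s`
  have hat : μ.real Y * μ.real {ω : BondConfig (Fin n) | (A.filter fun x => ω ∈ openConn o x).card = 0} ≤
      (1 - μ.real Y) * μ.real {ω : BondConfig (Fin n) | 2 ≤ (A.filter fun x => ω ∈ openConn o x).card} := by
    calc μ.real Y * μ.real {ω : BondConfig (Fin n) | (A.filter fun x => ω ∈ openConn o x).card = 0}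
        ≤ μ.real Y * μ.real (Xᶜ ∩ Yᶜ) := mul_le_mul_of_nonneg_left hm2 hq0
      _ ≤ (1 - μ.real Y) * μ.real (X ∩ Y) := hkey
      _ ≤ (1 - μ.real Y) * μ.real {ω : BondConfig (Fin n) | 2 ≤ (A.filter fun x => ω ∈ openConn o x).card} :=
          mul_le_mul_of_nonneg_left hm1 (by linarith [(measureReal_le_one : μ.real Y ≤ 1)])
  nlinarith [mul_le_mul_of_nonneg_right hs hE0, mul_le_mul_of_nonneg_right hs hP2]

/-- **Profile row `(1, 0)` unconditionally for `2 ≤ |A| ≤ 3`** (FAR vocabulary).  If `2 − (1 − t) < Σ_{a∈A} q_a` and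
`μ(o ↮ a) ≤ t` for every `a ∈ A` (so `t ≥ 1 − q_min`), then `(1 − t)·μ(N = 0) ≤ t·μ(N ≥ 2)`.  The largest `q` is `≥ ½`
(if `t < ½` every `q_a ≥ 1 − t > ½`; if `t ≥ ½` then `|A|·q_max ≥ Σ q > 1 + t ≥ 3/2`), so `profileRow_one_zero_of_half_le`
applies with `s = 1 − t`.  Row `(1, 1)` of the same family at `|A| = 3` is `OneCutFive.ZeroOneThree` (open). [this work] -/
theorem profileRow_one_zero_card_le_three (w : Sym2 (Fin n) → unitInterval) (A : Finset (Fin n)) (o : Fin n) (t : ℝ)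
    (h2 : 2 ≤ A.card) (h3 : A.card ≤ 3)
    (hsum : 2 - (1 - t) < ∑ a ∈ A, (prodBernoulli w).real (openConn o a))
    (hcut : ∀ a ∈ A, (prodBernoulli w).real (openConn o a)ᶜ ≤ t) :
    (1 - t) * (prodBernoulli w).real {ω : BondConfig (Fin n) | (A.filter fun x => ω ∈ openConn o x).card = 0} ≤
      t * (prodBernoulli w).real {ω : BondConfig (Fin n) | 2 ≤ (A.filter fun x => ω ∈ openConn o x).card} := by
  set μ := prodBernoulli w with hμ
  have hmeas : ∀ S : Set (BondConfig (Fin n)), MeasurableSet S := fun S => (Set.toFinite S).measurableSet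
  set q : Fin n → ℝ := fun a => μ.real (openConn o a : Set (BondConfig (Fin n))) with hq
  have hcompl : ∀ a, μ.real (openConn o a : Set (BondConfig (Fin n)))ᶜ = 1 - q a := fun a =>
    probReal_compl_eq_one_sub (hmeas _)
  have hqt : ∀ a ∈ A, 1 - t ≤ q a := fun a ha => by have := hcut a ha; rw [hcompl a] at this; linarith
  have hq1 : ∀ a, q a ≤ 1 := fun a => measureReal_le_one
  have hne : A.Nonempty := Finset.card_pos.1 (by omega)
  -- the most likely relay `a` and another relay `b`
  obtain ⟨a, ha, hamax⟩ := A.exists_max_image q hne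
  obtain ⟨b, hb, hba⟩ : ∃ b ∈ A, b ≠ a := by
    have : 1 < A.card := by omega
    obtain ⟨b, hb, hne'⟩ := Finset.exists_mem_ne this a
    exact ⟨b, hb, hne'⟩
  -- `q a ≥ ½`
  have hsumle : ∑ x ∈ A, q x ≤ A.card * q a := by
    have := Finset.sum_le_sum fun x hx => hamax x hx
    rw [Finset.sum_const, nsmul_eq_mul] at this
    exact this
  have hcard3 : (A.card : ℝ) ≤ 3 := by exact_mod_cast h3
  have hqa0 : 0 ≤ q a := measureReal_nonneg
  have hhalf : (1 : ℝ) / 2 ≤ q a := by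
    by_cases ht : t < 1 / 2
    · linarith [hqt a ha]
    · have ht : (1 : ℝ) / 2 ≤ t := le_of_not_gt ht
      have h1 : 2 - (1 - t) < A.card * q a := lt_of_lt_of_le hsum hsumle
      nlinarith
  have key := profileRow_one_zero_of_half_le w A o a b ha hb hba.symm (hamax b hb) hhalf (1 - t) (hqt b hb)
  rw [← hμ] at key
  have : (1 : ℝ) - (1 - t) = t := by ring
  rw [this] at key
  exact key

/-- Reverse counting bound: if on `S` at most `c` of the events `E k` (`k ∈ s`) occur, then `Σ_k μ(S ∩ E k) ≤ c · μ(S)`. [folklore] -/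
theorem sum_measureReal_inter_le_mul {α κ : Type*} [MeasurableSpace α] (μ : Measure α) [IsFiniteMeasure μ]
    (s : Finset κ) (E : κ → Set α) (hE : ∀ k ∈ s, MeasurableSet (E k)) {S : Set α} (hS : MeasurableSet S) (c : ℝ)
    (hc : ∀ ω ∈ S, ∑ k ∈ s, (E k).indicator (fun _ => (1 : ℝ)) ω ≤ c) :
    ∑ k ∈ s, μ.real (S ∩ E k) ≤ c * μ.real S := by
  have hint : ∀ k ∈ s, Integrable ((S ∩ E k).indicator fun _ => (1 : ℝ)) μ :=
    fun k hk => (integrable_const (1 : ℝ)).indicator (hS.inter (hE k hk))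
  have h1 : ∀ k ∈ s, μ.real (S ∩ E k) = ∫ ω, (S ∩ E k).indicator (fun _ => (1 : ℝ)) ω ∂μ := by
    intro k hk
    rw [integral_indicator_const _ (hS.inter (hE k hk)), smul_eq_mul, mul_one]
  have h2 : c * μ.real S = ∫ ω, S.indicator (fun _ => c) ω ∂μ := by
    rw [integral_indicator_const _ hS, smul_eq_mul, mul_comm]
  rw [h2, Finset.sum_congr rfl h1, ← integral_finsetSum s hint]
  refine integral_mono (integrable_finsetSum s hint) ((integrable_const c).indicator hS) fun ω => ?_
  by_cases hω : ω ∈ S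
  · rw [Set.indicator_of_mem hω]
    refine le_trans (le_of_eq (Finset.sum_congr rfl fun k _ => ?_)) (hc ω hω)
    by_cases hk : ω ∈ E k
    · rw [Set.indicator_of_mem (Set.mem_inter hω hk), Set.indicator_of_mem hk]
    · rw [Set.indicator_of_notMem (fun h => hk h.2), Set.indicator_of_notMem hk]
  · rw [Set.indicator_of_notMem hω]
    refine le_of_eq (Finset.sum_eq_zero fun k _ => ?_)
    rw [Set.indicator_of_notMem (fun h => hω h.1)]

/-- First-moment bound with the layer split: `Σ_{a∈A} q_a ≤ j·μ(1 ≤ N ≤ j) + |A|·μ(N ≥ j+1)` (on `{1 ≤ N ≤ j}` at most `j` relays are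
joined to `o`, on `{N ≥ j+1}` at most `|A|`, on `{N = 0}` none). [folklore; first-moment counting] -/
theorem sum_conn_le_layer_split (w : Sym2 (Fin n) → unitInterval) (A : Finset (Fin n)) (o : Fin n) (j : ℕ) :
    ∑ a ∈ A, (prodBernoulli w).real (openConn o a : Set (BondConfig (Fin n))) ≤
      (j : ℝ) * (prodBernoulli w).real {ω : BondConfig (Fin n) | 1 ≤ (A.filter fun a => ω ∈ openConn o a).card ∧
          (A.filter fun a => ω ∈ openConn o a).card ≤ j} +
        (A.card : ℝ) * (prodBernoulli w).real {ω : BondConfig (Fin n) | j + 1 ≤ (A.filter fun a => ω ∈ openConn o a).card} := by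
  set μ := prodBernoulli w with hμ
  have hmeas : ∀ S : Set (BondConfig (Fin n)), MeasurableSet S := fun S => (Set.toFinite S).measurableSet
  set S1 : Set (BondConfig (Fin n)) := {ω | 1 ≤ (A.filter fun a => ω ∈ openConn o a).card ∧
      (A.filter fun a => ω ∈ openConn o a).card ≤ j} with hS1
  set S2 : Set (BondConfig (Fin n)) := {ω | j + 1 ≤ (A.filter fun a => ω ∈ openConn o a).card} with hS2
  have hsplit : ∀ a ∈ A, μ.real (openConn o a : Set (BondConfig (Fin n))) =
      μ.real (S1 ∩ openConn o a) + μ.real (S2 ∩ openConn o a) := by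
    intro a ha
    have hset : (openConn o a : Set (BondConfig (Fin n))) = (S1 ∩ openConn o a) ∪ (S2 ∩ openConn o a) := by
      ext ω
      simp only [Set.mem_union, Set.mem_inter_iff, hS1, hS2, Set.mem_setOf_eq]
      constructor
      · intro hω
        have h1 : 1 ≤ (A.filter fun a => ω ∈ openConn o a).card :=
          Finset.card_pos.2 ⟨a, Finset.mem_filter.2 ⟨ha, hω⟩⟩
        by_cases hj : (A.filter fun a => ω ∈ openConn o a).card ≤ j
        · exact Or.inl ⟨⟨h1, hj⟩, hω⟩
        · exact Or.inr ⟨by omega, hω⟩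
      · rintro (⟨-, h⟩ | ⟨-, h⟩) <;> exact h
    have hdisj : Disjoint (S1 ∩ openConn o a) (S2 ∩ (openConn o a : Set (BondConfig (Fin n)))) := by
      rw [Set.disjoint_left]
      rintro ω ⟨⟨-, h1⟩, -⟩ ⟨h2, -⟩
      exact absurd (le_trans h2 h1) (by omega)
    have hun := measureReal_union (μ := μ) hdisj (hmeas (S2 ∩ (openConn o a : Set (BondConfig (Fin n)))))
    rw [← hset] at hun
    exact hun
  rw [Finset.sum_congr rfl hsplit, Finset.sum_add_distrib]
  have hA : ∑ a ∈ A, μ.real (S1 ∩ openConn o a) ≤ (j : ℝ) * μ.real S1 := by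
    refine sum_measureReal_inter_le_mul μ A (fun a => (openConn o a : Set (BondConfig (Fin n)))) (fun a _ => hmeas _)
      (hmeas S1) (j : ℝ) fun ω hω => ?_
    rw [← halfLeSevenForms_card_filter_eq_sum_indicator]
    exact_mod_cast hω.2
  have hB : ∑ a ∈ A, μ.real (S2 ∩ openConn o a) ≤ (A.card : ℝ) * μ.real S2 := by
    refine sum_measureReal_inter_le_mul μ A (fun a => (openConn o a : Set (BondConfig (Fin n)))) (fun a _ => hmeas _)
      (hmeas S2) (A.card : ℝ) fun ω _ => ?_
    rw [← halfLeSevenForms_card_filter_eq_sum_indicator]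
    exact_mod_cast Finset.card_filter_le A _
  linarith

/-- **Profile row `(j, 0)` for EVERY relay set, first-moment proof: `EN ≥ j` suffices.**  For every finite weighted graph, `o`, nonempty `A`, `j`, `t`:
if `j ≤ Σ_{a∈A} q_a` and `μ(o ↮ a) ≤ t` on `A`, then `(1 − t)·μ(N = 0) ≤ t·μ(N ≥ j+1)`.  Proof: with `u = μ(N ≥ 1) ≥ 1 − t`, `v = μ(N ≥ j+1)`,
`s = 1 − t`: `EN ≤ j·u + (|A| − j)·v` (`sum_conn_le_layer_split`), `EN ≥ |A|·s`, and the identity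
`(1−s)(EN − j u) − (|A|−j) s (1−u) = (1−u)(EN − |A| s) + (u − s)(EN − j) ≥ 0`.  By the augmentation identity (memo §13.2(a)) this is FAR at
layer `j` for `A ∪ {a glued blob of j relays hung at o by one edge of weight q_min}` as soon as `EN_A ≥ j`; it supersedes the `½`-conditions of
`profileRow_one_zero_of_half_le` / `_card_le_three` for the rows `ℓ = 0` (the rows with `ℓ ≥ 1`, in particular FAR itself, are NOT first-moment rows).
Sharp threshold at `j = 1`: two independent relays of weight `½` (`EN = 1`, equality); below it the row fails (two independent `0.45`-relays). [this work; first-moment counting] -/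
theorem profileRow_zero (w : Sym2 (Fin n) → unitInterval) (A : Finset (Fin n)) (o : Fin n) (j : ℕ) (t : ℝ) (hne : A.Nonempty)
    (hEN : (j : ℝ) ≤ ∑ a ∈ A, (prodBernoulli w).real (openConn o a))
    (hcut : ∀ a ∈ A, (prodBernoulli w).real (openConn o a)ᶜ ≤ t) :
    (1 - t) * (prodBernoulli w).real {ω : BondConfig (Fin n) | (A.filter fun a => ω ∈ openConn o a).card = 0} ≤
      t * (prodBernoulli w).real {ω : BondConfig (Fin n) | j + 1 ≤ (A.filter fun a => ω ∈ openConn o a).card} := by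
  set μ := prodBernoulli w with hμ
  have hmeas : ∀ S : Set (BondConfig (Fin n)), MeasurableSet S := fun S => (Set.toFinite S).measurableSet
  set q : Fin n → ℝ := fun a => μ.real (openConn o a : Set (BondConfig (Fin n))) with hq
  set s : ℝ := 1 - t with hs
  have hcompl : ∀ a, μ.real (openConn o a : Set (BondConfig (Fin n)))ᶜ = 1 - q a := fun a =>
    probReal_compl_eq_one_sub (hmeas _)
  have hqs : ∀ a ∈ A, s ≤ q a := fun a ha => by have := hcut a ha; rw [hcompl a] at this; rw [hs]; linarith
  set S0 : Set (BondConfig (Fin n)) := {ω | (A.filter fun a => ω ∈ openConn o a).card = 0} with hS0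
  set S1 : Set (BondConfig (Fin n)) := {ω | 1 ≤ (A.filter fun a => ω ∈ openConn o a).card ∧
      (A.filter fun a => ω ∈ openConn o a).card ≤ j} with hS1
  set S2 : Set (BondConfig (Fin n)) := {ω | j + 1 ≤ (A.filter fun a => ω ∈ openConn o a).card} with hS2
  set EN : ℝ := ∑ a ∈ A, q a with hEN'
  set m : ℝ := (A.card : ℝ) with hm
  -- first-moment split
  have hsplit : EN ≤ (j : ℝ) * μ.real S1 + m * μ.real S2 := sum_conn_le_layer_split w A o j
  -- `EN ≥ |A|·s`
  have hms : m * s ≤ EN := by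
    have := Finset.sum_le_sum hqs
    rw [Finset.sum_const, nsmul_eq_mul] at this
    exact this
  -- `u := μ(N ≥ 1) = μ S1 + μ S2 = 1 − μ S0`, and `u ≥ q a₀ ≥ s`
  obtain ⟨a₀, ha₀⟩ := hne
  have hU : (S0)ᶜ = S1 ∪ S2 := by
    ext ω
    simp only [Set.mem_compl_iff, hS0, hS1, hS2, Set.mem_setOf_eq, Set.mem_union]
    omega
  have hdisj : Disjoint S1 S2 := by
    rw [Set.disjoint_left]
    rintro ω ⟨-, h1⟩ h2
    exact absurd (le_trans h2 h1) (by omega)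
  have hu : μ.real S1 + μ.real S2 = 1 - μ.real S0 := by
    rw [← measureReal_union hdisj (hmeas _), ← hU, probReal_compl_eq_one_sub (hmeas _)]
  have hsub : (openConn o a₀ : Set (BondConfig (Fin n))) ⊆ S0ᶜ := by
    intro ω hω h0
    have : a₀ ∈ A.filter fun a => ω ∈ openConn o a := Finset.mem_filter.2 ⟨ha₀, hω⟩
    have h0' : (A.filter fun a => ω ∈ openConn o a).card = 0 := h0
    rw [Finset.card_eq_zero] at h0'
    rw [h0'] at this
    exact Finset.notMem_empty a₀ this
  have hua : q a₀ ≤ 1 - μ.real S0 := by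
    have h1 := measureReal_mono hsub (measure_ne_top μ _)
    rwa [probReal_compl_eq_one_sub (hmeas _)] at h1
  have hus : s ≤ 1 - μ.real S0 := le_trans (hqs a₀ ha₀) hua
  have hS0nn : 0 ≤ μ.real S0 := measureReal_nonneg
  have hS1nn : 0 ≤ μ.real S1 := measureReal_nonneg
  have hS2nn : 0 ≤ μ.real S2 := measureReal_nonneg
  have hS2le : μ.real S2 ≤ 1 := measureReal_le_one
  have hkey : 0 ≤ μ.real S0 * (EN - m * s) + (1 - μ.real S0 - s) * (EN - j) :=
    add_nonneg (mul_nonneg hS0nn (by linarith)) (mul_nonneg (by linarith) (by linarith))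
  show s * μ.real S0 ≤ t * μ.real S2
  have ht : t = 1 - s := by rw [hs]; ring
  rw [ht]
  by_cases hmj : (j : ℝ) < m
  · -- `(m − j)·[(1−s) v − s μ S0] ≥ (1−s)(EN − j u) − (m−j) s μ S0 = key ≥ 0`
    nlinarith [hsplit, hkey, hu, mul_nonneg (sub_nonneg.2 (le_of_lt hmj)) hS2nn]
  · -- `|A| ≤ j`: then `EN ≤ j u` forces `u = 1`, i.e. `μ S0 = 0`
    have hmj' : m ≤ (j : ℝ) := le_of_not_gt hmj
    have hm1 : (1 : ℝ) ≤ m := by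
      rw [hm]; exact_mod_cast Finset.card_pos.2 ⟨a₀, ha₀⟩
    have hj1 : (1 : ℝ) ≤ (j : ℝ) := le_trans hm1 hmj'
    have h1 : EN ≤ (j : ℝ) * (μ.real S1 + μ.real S2) := by
      nlinarith [hsplit, mul_nonneg (sub_nonneg.2 hmj') hS2nn]
    rw [hu] at h1
    have h2 : (j : ℝ) * μ.real S0 ≤ 0 := by linarith
    have h0 : μ.real S0 = 0 := le_antisymm (by nlinarith [h2, hj1, hS0nn]) hS0nn
    rw [h0, mul_zero]
    exact mul_nonneg (by linarith) hS2nn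

end Quant

end Summit.CriticalPhenomena.PercolationContinuityZ3.Theorems

end
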